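import Summits.BirchSwinnertonDyer.BirchSwinnertonDyer.Theorems.ErratumRoadFiveNonSurjCornerSerreLevelExact
import Literature.NumberTheory.DiophantineGeometry.GeneralizedFermatTwoPowerCoefficientSerreProofs
import HarnessLib

/-!
# Route `ErratumRoadFive` (K2, `p ≥ 5`), crux `NonSurjCorner` (item stmt-BirchSwinnertonDyer-19065), child `NonSurjCornerTwinMuAn` (19948):
# THE EXACT-LEVEL DOOR ON `Γ₀(N_add)` WHEN NO ADDITIVE PRIME IS `≡ 1 (mod p)`
# (cell `bsd-stepL`, WIDTH-LEVER lane B `bsd-stepL-corner5-p2` g11; `--supports stmt-BirchSwinnertonDyer-19948 --as helper`)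

WHAT. The exact-level door `…SerreLevelExact.exists_newform_two_serreLevel_of_not_ram_of_dvd` produces a newform `f ∈ S₂(Γ₁(N))`, `N = N(ρ̄) = N_add(E)`.
Its nebentypus `ε_f` reduces to `det ρ̄ · χ̄⁻¹ = 1` mod `℘`; it is trivial outright as soon as `p ∤ φ(N)` (the tree's
`nebentypus_eq_one_of_isGaloisRepOfNewform1Int_of_not_dvd_totient`, Serre 1987 §3.3), and then `f` is (the `Γ₁`-lift of) a newform on `Γ₀(N)`
(`exists_isNewform0_coe_eq_of_nebentypus_eq_one`). Since `N = ∏_{q additive} q^{f_q}` EXACTLY, `φ(N) = ∏ q^{f_q − 1}(q − 1)` and `p ∤ φ(N)` iff NO ADDITIVE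
PRIME `q` of `E` has `q ≡ 1 (mod p)` (`q ≠ p` automatically: `p` is multiplicative):

* `not_dvd_totient_of_forall_prime` — `p ∤ φ(N)` when every prime `q ∣ N` has `q ≠ p` and `p ∤ q − 1` (Euler's product);
* `exists_newform0_two_serreLevel_of_not_ram_of_dvd` — THE `Γ₀` DOOR AT THE EXACT LEVEL: corner hypotheses + «no additive prime `≡ 1 (mod p)`» ⟹
  `E[p] ⊗ 𝔽̄_p ≅ ρ̄_g` for a newform `g ∈ S₂(Γ₀(N))`, `N = N_add(E)` (Khare–Wintenberger + Ogg–Saito BY NAME).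

WHY (lane B census by Serre level, HOME/corner5/g11): the census enumerates `Γ₀(M)`-newforms at the conductor-shaped levels `M`; this file says the
enumeration is complete BY NAME (Khare–Wintenberger, Ogg–Saito) at every level without a prime factor `≡ 1 (mod p)` — at the others (at `p = 5`: levels
divisible by `11², 31², 41², 61², 71², …`) completeness still rests on Carayol's character lemma in print (Carayol 1989, Prop. 3). HONEST FRAMING:
conditional on `khare_wintenberger` and Ogg–Saito BY NAME; no `sorry`, no new definition, no new named fact; items 19065 ∕ 19948 NOT closed; BSD
proved for no curve. [cite: Serre1987, §3.3] [cite: KhareWintenberger2009, Thm. 1.2 and Thm. 9.1] [cite: Carayol1989, Prop. 3] [cite: Kraus1997, p. 1143]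
-/

set_option autoImplicit false
set_option linter.dupNamespace false

noncomputable section

open scoped Classical MatrixGroups ModularForm NumberField

open WeierstrassCurve Literature.NumberTheory Literature.NumberTheory.GaloisRepresentations
  Literature.NumberTheory.EllipticCurves Literature.NumberTheory.EllipticCurves.ModularForms
  Rat.HeightOneSpectrum IsDedekindDomain IsDedekindDomain.HeightOneSpectrum
  Literature.NumberTheory.Automorphic Literature.NumberTheory.Automorphic.BCDT
  Literature.NumberTheory.DiophantineGeometry Literature.NumberTheory.EllipticCurves.Rank1Residual
  Literature.NumberTheory.GaloisRepresentations.ModPGaloisRep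
  Literature.NumberTheory.GaloisRepresentations.IsNonarchimedeanLocalField
  CongruenceSubgroup
  Summit.BirchSwinnertonDyer.Rank1Residual Summit.BirchSwinnertonDyer.Rank1Residual.X11b

namespace Summit.BirchSwinnertonDyer.BirchSwinnertonDyer.Theorems.NonSurjCornerSerreLevelExact

/-- **`p ∤ φ(N)`** when every prime `q ∣ N` satisfies `q ≠ p` and `p ∤ q − 1` (`N ≠ 0`): Euler's product `φ(N) = ∏_{q^k ∥ N} q^{k−1}(q − 1)`
(`Nat.totient_eq_prod_factorization`) has no factor divisible by the prime `p`. [folklore] -/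
theorem not_dvd_totient_of_forall_prime {p N : ℕ} (hp : p.Prime) (hN : N ≠ 0)
    (h : ∀ q : ℕ, q.Prime → q ∣ N → q ≠ p ∧ ¬ p ∣ q - 1) : ¬ p ∣ Nat.totient N := by
  rw [Nat.totient_eq_prod_factorization hN]
  refine hp.prime.not_dvd_finsuppProd fun q hq ↦ ?_
  have hqprime : q.Prime := Nat.prime_of_mem_primeFactors hq
  have hqN : q ∣ N := Nat.dvd_of_mem_primeFactors hq
  obtain ⟨hqp, hq1⟩ := h q hqprime hqN
  intro hdvd
  rcases (Nat.Prime.dvd_mul hp).mp hdvd with h1 | h1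
  · exact hqp ((Nat.prime_dvd_prime_iff_eq hp hqprime).mp (hp.dvd_of_dvd_pow h1)).symm
  · exact hq1 h1

/-- **THE `Γ₀` DOOR AT THE EXACT LEVEL.** On the corner locus (`p ≥ 5` multiplicative, `E[p]` irreducible, NO (ram) prime, `p ∣ ord_p Δ_min`), if NO
additive prime `q` of `E` is `≡ 1 (mod p)` (`p ∤ q − 1`), then — granted `khare_wintenberger` and Ogg–Saito BY NAME — `E[p] ⊗ 𝔽̄_p ≅ ρ̄_f` for a newform
`f ∈ S₂(Γ₁(N))` with TRIVIAL nebentypus, i.e. the lift of a newform `g ∈ S₂(Γ₀(N))`, at the level `N = N(ρ̄) = N_add(E)` EXACTLY (`ord_q N = ord_q N_E` at the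
additive `q`, `0` elsewhere). Proof: the exact door; every prime `q ∣ N` is additive (`ord_q N ≠ 0`), hence `q ≠ p` and `p ∤ q − 1`, so `p ∤ φ(N)`
(`not_dvd_totient_of_forall_prime`); then `ε_f = 1` (`nebentypus_eq_one_of_isGaloisRepOfNewform1Int_of_not_dvd_totient`, no prime beyond `N_E` is bad)
and `f` descends to `Γ₀(N)` (`exists_isNewform0_coe_eq_of_nebentypus_eq_one`). [cite: Serre1987, §3.3] [cite: KhareWintenberger2009, Thm. 1.2 and Thm. 9.1]
[cite: Kraus1997, p. 1143] -/
theorem exists_newform0_two_serreLevel_of_not_ram_of_dvd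
    (p : ℕ) [Fact p.Prime] [TopologicalSpace (AlgebraicClosure (ZMod p))] [DiscreteTopology (AlgebraicClosure (ZMod p))]
    (hKW : khare_wintenberger p (AlgebraicClosure (ZMod p)))
    (hOS : ∀ (W : WeierstrassCurve ℚ) (ℓ : ℕ) [Fact ℓ.Prime],
      W.artinConductorExponent_tate_eq_conductorExponent_of_isElliptic ℓ)
    (W : WeierstrassCurve ℚ) [W.IsElliptic] [W.IsGloballyMinimal]
    (hp5 : 5 ≤ p) (hmultp : Mult W p) (hirr : Irr W p) (hnram : ¬ Ram W p)
    (hpeu : p ∣ padicValInt p W.minimalDiscriminantInt)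
    (h1 : ∀ (q : ℕ) [Fact q.Prime], ¬ W.HasGoodReductionAtPrime q → ¬ W.HasMultiplicativeReductionAtPrime q → ¬ p ∣ q - 1)
    {ρ : ModPGaloisRep ℚ (ZMod p) 2} (hρ : W.IsTorsionGaloisRep p ρ) :
    ∃ (N : ℕ) (_ : NeZero N),
      N = serreLevel p (FramedRep.baseChange (algebraMap (ZMod p) (AlgebraicClosure (ZMod p)))
            continuous_of_discreteTopology ρ) ∧
      (∀ (q : ℕ) [Fact q.Prime], N.factorization q =
        if ¬ W.HasGoodReductionAtPrime q ∧ ¬ W.HasMultiplicativeReductionAtPrime q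
        then (W.conductorNorm ℤ).factorization q else 0) ∧
      N ∣ W.conductorNorm ℤ ∧ ¬ p ∣ N ∧ ¬ p ∣ Nat.totient N ∧
      ∃ (f : CuspForm (Gamma1 N) 2)
        (ιf : coeffCharIntegers f →+* AlgebraicClosure (ZMod p)) (g : CuspForm (Gamma0 N) 2),
        IsNewform1 f ∧ nebentypus f = 1 ∧ IsNewform0 g ∧ (⇑g : UpperHalfPlane → ℂ) = ⇑f ∧
        IsGaloisRepOfNewform1Int f ιf {q | q ∣ N * p}
          (FramedRep.baseChange (algebraMap (ZMod p) (AlgebraicClosure (ZMod p)))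
            continuous_of_discreteTopology ρ) := by
  classical
  have hp : p.Prime := Fact.out
  obtain ⟨N, hNz, hNeq, hfac, hNdvd, hpN, f, ιf, hf, hgal⟩ :=
    exists_newform_two_serreLevel_of_not_ram_of_dvd p hKW hOS W hp5 hmultp hirr hnram hpeu hρ
  haveI : NeZero N := hNz
  haveI : NeZero (W.conductorNorm ℤ) := ⟨(conductorNorm_pos_holds W).ne'⟩
  -- every prime of `N` is an additive prime `≠ p` with `p ∤ q - 1`
  have htot : ¬ p ∣ Nat.totient N := by
    refine not_dvd_totient_of_forall_prime hp hNz.out fun q hq hqN ↦ ?_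
    haveI : Fact q.Prime := ⟨hq⟩
    have hne : N.factorization q ≠ 0 :=
      Nat.one_le_iff_ne_zero.mp ((hq.dvd_iff_one_le_factorization hNz.out).mp hqN)
    have hadd : ¬ W.HasGoodReductionAtPrime q ∧ ¬ W.HasMultiplicativeReductionAtPrime q := by
      by_contra hna
      rw [hfac q, if_neg hna] at hne
      exact hne rfl
    refine ⟨?_, h1 q hadd.1 hadd.2⟩
    rintro rfl
    exact hadd.2 hmultp
  have hε : nebentypus f = 1 :=
    nebentypus_eq_one_of_isGaloisRepOfNewform1Int_of_not_dvd_totient W hρ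
      (algebraMap (ZMod p) (AlgebraicClosure (ZMod p))) htot ιf hgal (W.conductorNorm ℤ)
      fun q _ hqB hqd ↦ absurd (Nat.le_of_dvd (conductorNorm_pos_holds W) hqd) (not_le.mpr hqB)
  obtain ⟨g, hg, hgf⟩ := exists_isNewform0_coe_eq_of_nebentypus_eq_one hf hε
  exact ⟨N, hNz, hNeq, hfac, hNdvd, hpN, htot, f, ιf, g, hf, hε, hg, hgf, hgal⟩

/-- **19948's population through the `Γ₀` door at the exact level** (leaf twins `Wd ∈ ClassX11a`, `p ∈ {5, 7}`, `p ∣ ord_p Δ_min`; no additive prime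
`≡ 1 (mod p)`): `Wd[p] ⊗ 𝔽̄_p ≅ ρ̄_g`, `g` new on `Γ₀(N_add(Wd))`. Granted `khare_wintenberger` and Ogg–Saito BY NAME.
[cite: KhareWintenberger2009, Thm. 1.2 and Thm. 9.1] [cite: Serre1987, §3.3] -/
theorem NonSurjTwin.exists_newform0_two_serreLevel
    (p : ℕ) [Fact p.Prime] [TopologicalSpace (AlgebraicClosure (ZMod p))] [DiscreteTopology (AlgebraicClosure (ZMod p))]
    (hKW : khare_wintenberger p (AlgebraicClosure (ZMod p)))
    (hOS : ∀ (W : WeierstrassCurve ℚ) (ℓ : ℕ) [Fact ℓ.Prime],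
      W.artinConductorExponent_tate_eq_conductorExponent_of_isElliptic ℓ)
    (Wd : WeierstrassCurve ℚ) [Wd.IsElliptic] [Wd.IsGloballyMinimal]
    (hX : ClassX11a Wd p) (hp : p = 5 ∨ p = 7) (hpeu : p ∣ padicValInt p Wd.minimalDiscriminantInt)
    (h1 : ∀ (q : ℕ) [Fact q.Prime], ¬ Wd.HasGoodReductionAtPrime q → ¬ Wd.HasMultiplicativeReductionAtPrime q → ¬ p ∣ q - 1)
    {ρ : ModPGaloisRep ℚ (ZMod p) 2} (hρ : Wd.IsTorsionGaloisRep p ρ) :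
    ∃ (N : ℕ) (_ : NeZero N),
      N = serreLevel p (FramedRep.baseChange (algebraMap (ZMod p) (AlgebraicClosure (ZMod p)))
            continuous_of_discreteTopology ρ) ∧
      (∀ (q : ℕ) [Fact q.Prime], N.factorization q =
        if ¬ Wd.HasGoodReductionAtPrime q ∧ ¬ Wd.HasMultiplicativeReductionAtPrime q
        then (Wd.conductorNorm ℤ).factorization q else 0) ∧
      N ∣ Wd.conductorNorm ℤ ∧ ¬ p ∣ N ∧ ¬ p ∣ Nat.totient N ∧
      ∃ (f : CuspForm (Gamma1 N) 2)
        (ιf : coeffCharIntegers f →+* AlgebraicClosure (ZMod p)) (g : CuspForm (Gamma0 N) 2),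
        IsNewform1 f ∧ nebentypus f = 1 ∧ IsNewform0 g ∧ (⇑g : UpperHalfPlane → ℂ) = ⇑f ∧
        IsGaloisRepOfNewform1Int f ιf {q | q ∣ N * p}
          (FramedRep.baseChange (algebraMap (ZMod p) (AlgebraicClosure (ZMod p)))
            continuous_of_discreteTopology ρ) :=
  exists_newform0_two_serreLevel_of_not_ram_of_dvd p hKW hOS Wd (by rcases hp with rfl | rfl <;> norm_num)
    hX.2.2.1 hX.2.2.2.1 hX.2.2.2.2 hpeu h1 hρ

end Summit.BirchSwinnertonDyer.BirchSwinnertonDyer.Theorems.NonSurjCornerSerreLevelExact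

end
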